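import Literature.Analysis.FluidPDE.CheskidovShvydkoyAssembly
import Literature.Analysis.FluidPDE.CheskidovDaiApriori
import Literature.Analysis.FluidPDE.CheskidovDaiCut
import Literature.Analysis.FluidPDE.CheskidovDaiMeasurable
import HarnessLib

/-!
# One piece of the Cheskidov–Dai bootstrap: the low-mode two-point inequality from a good time

Analysis/FluidPDE support file (serves the discharge of the named fact
`Literature.Analysis.FluidPDE.cheskidov_dai_occupation_regular` — Cheskidov–Dai, arXiv:1507.06611 =
Proc. Edinburgh Math. Soc. (2025), Thm. 1.1). The twin of `CheskidovShvydkoyAssembly.piece` with the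
low-mode rate: from a good restarting time `σ` of a Leray–Hopf solution `u`, Leray's regular local
solution `v` (`LerayLocalRegularH1With`) coincides with `u(σ + ·)` (weak–strong uniqueness), and on every
compact sub-slab `[σ + a', σ + b']` the dyadic energy `f(t) = F(u(t)).toReal` satisfies the two-point
inequality of `CheskidovDaiApriori` with the interval functional
`ω(s,t) = 2 (B_f ∫⁻_{(s,t]} f_{J(τ)}(u(τ)) dτ).toReal`, `J(τ)` the canonical top saturated level of the
slice `u(τ)` at threshold `c ν` (`CheskidovDaiCut`), provided the low-mode bound on the weighted nonlinear
terms holds for smooth divergence-free slices (hypothesis `hNL`: the output of `CheskidovDaiWeightedSum`)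
and `B_κ (cν) C_r² d ≤ ν`. It also records the boundedness of `f` and the a.e.-measurability of the
occupation integrands on the sub-slab (`CheskidovDaiMeasurable`).

## References

* A. Cheskidov, M. Dai, arXiv:1507.06611 = Proc. Edinburgh Math. Soc. (2025), §3.1. [CheskidovDai2015]
* A. Cheskidov, R. Shvydkoy, Arch. Ration. Mech. Anal. 195 (2010), Lemma 3.2 (proof). [CheskidovShvydkoy2010]
-/

noncomputable section

open MeasureTheory Filter Topology Function Set
open Literature.Analysis.FunctionSpaces
open scoped ENNReal NNReal RealInnerProductSpace

namespace Literature.Analysis.FluidPDE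

section PieceLowMode

open LPBounds

variable {ν T : ℝ} {u₀ : EuclideanSpace ℝ (Fin 3) → EuclideanSpace ℝ (Fin 3)}
  {u : ℝ → EuclideanSpace ℝ (Fin 3) → EuclideanSpace ℝ (Fin 3)}

/-- On a smooth slab the saturated levels are bounded: if level `j` of a slice with `F ≤ F_max` is
saturated at threshold `c ν > 0` then `2^j ≤ M` with `M` depending on `F_max`, `c ν` and `C_∞`
(`ofReal_mul_two_pow_le_of_isSaturatedLevel` in dimension `3`: `cν 2^j ≤ 20 C_∞ 2^{j/2} F^{1/2}`). [cite: CheskidovDai2015, §3.1 (3.9)] -/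
theorem exists_bound_saturatedLevel (K : LPBounds (Fin 3)) {c ν : ℝ} (hcν : 0 < c * ν) {Fmax : ℝ≥0∞} (hF : Fmax ≠ ∞) :
    ∃ N : ℕ, ∀ (w : EuclideanSpace ℝ (Fin 3) → EuclideanSpace ℝ (Fin 3)), IsSmoothL2Field w → dyadicF w ≤ Fmax →
      ∀ j : ℕ, IsSaturatedLevel c ν w j → j ≤ N := by
  -- `cν 2^j ≤ 20 C_∞ 2^{3j/2} 2^{-j} F^{1/2} = 20 C_∞ 2^{j/2} F^{1/2}`, i.e. `2^{j/2} ≤ 20 C_∞ F^{1/2} / (cν)`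
  set R : ℝ≥0∞ := 20 * (K.Cinf * Fmax ^ (1 / 2 : ℝ)) / ENNReal.ofReal (c * ν) with hR
  have hRtop : R ≠ ∞ := ENNReal.div_ne_top (ENNReal.mul_ne_top (by norm_num)
    (ENNReal.mul_ne_top ENNReal.coe_ne_top (ENNReal.rpow_ne_top_of_nonneg (by norm_num) hF))) (by rwa [ne_eq, ENNReal.ofReal_eq_zero, not_le])
  obtain ⟨N, hN⟩ := exists_nat_gt (R.toReal ^ 2)
  refine ⟨N, fun w hw hFw j hj => ?_⟩
  by_contra hjN
  push Not at hjN
  have h := ofReal_mul_two_pow_le_of_isSaturatedLevel K hw hj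
  have h2ne : (2 : ℝ≥0∞) ≠ 0 := two_ne_zero
  have h2top : (2 : ℝ≥0∞) ≠ ∞ := ENNReal.ofNat_ne_top
  have hd : (Module.finrank ℝ (EuclideanSpace ℝ (Fin 3)) : ℝ) = 3 := by rw [finrank_euclideanSpace, Fintype.card_fin]; norm_num
  rw [hd] at h
  -- rewrite the right-hand side as `20 C_∞ 2^{j/2} F^{1/2}`... and compare with `cν 2^j = cν 2^{j/2} 2^{j/2}`
  have hpow : (2 : ℝ≥0∞) ^ (((j : ℤ) : ℝ) * 3 * 2⁻¹) * (2 : ℝ≥0∞) ^ (-(j : ℤ)) = (2 : ℝ≥0∞) ^ ((j : ℝ) / 2) := by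
    rw [← ENNReal.rpow_intCast, ← ENNReal.rpow_add _ _ h2ne h2top]
    congr 1; push_cast; ring
  have hj2 : (2 : ℝ≥0∞) ^ (j : ℕ) = (2 : ℝ≥0∞) ^ ((j : ℝ) / 2) * (2 : ℝ≥0∞) ^ ((j : ℝ) / 2) := by
    rw [← ENNReal.rpow_add _ _ h2ne h2top, ← ENNReal.rpow_natCast]; congr 1; ring
  have h' : ENNReal.ofReal (c * ν) * ((2 : ℝ≥0∞) ^ ((j : ℝ) / 2) * (2 : ℝ≥0∞) ^ ((j : ℝ) / 2)) ≤
      20 * (K.Cinf * Fmax ^ (1 / 2 : ℝ)) * (2 : ℝ≥0∞) ^ ((j : ℝ) / 2) := by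
    rw [← hj2]
    calc ENNReal.ofReal (c * ν) * (2 : ℝ≥0∞) ^ (j : ℕ)
        ≤ 20 * (K.Cinf * (2 : ℝ≥0∞) ^ (((j : ℤ) : ℝ) * 3 * 2⁻¹) * ((2 : ℝ≥0∞) ^ (-(j : ℤ)) * dyadicF w ^ (1 / 2 : ℝ))) := h
      _ = 20 * (K.Cinf * dyadicF w ^ (1 / 2 : ℝ)) * ((2 : ℝ≥0∞) ^ (((j : ℤ) : ℝ) * 3 * 2⁻¹) * (2 : ℝ≥0∞) ^ (-(j : ℤ))) := by ring
      _ = 20 * (K.Cinf * dyadicF w ^ (1 / 2 : ℝ)) * (2 : ℝ≥0∞) ^ ((j : ℝ) / 2) := by rw [hpow]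
      _ ≤ 20 * (K.Cinf * Fmax ^ (1 / 2 : ℝ)) * (2 : ℝ≥0∞) ^ ((j : ℝ) / 2) := by gcongr
  -- cancel one factor `2^{j/2}` and conclude `2^{j/2} ≤ R`
  have hq0 : (2 : ℝ≥0∞) ^ ((j : ℝ) / 2) ≠ 0 := (ENNReal.rpow_pos (by norm_num) h2top).ne'
  have hqtop : (2 : ℝ≥0∞) ^ ((j : ℝ) / 2) ≠ ∞ := ENNReal.rpow_ne_top_of_nonneg (by positivity) h2top
  have h3 : ENNReal.ofReal (c * ν) * (2 : ℝ≥0∞) ^ ((j : ℝ) / 2) ≤ 20 * (K.Cinf * Fmax ^ (1 / 2 : ℝ)) := by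
    rw [← mul_assoc] at h'
    exact (ENNReal.mul_le_mul_iff_left hq0 hqtop).1 h'
  have h4 : (2 : ℝ≥0∞) ^ ((j : ℝ) / 2) ≤ R := by
    rw [hR, ENNReal.le_div_iff_mul_le (Or.inl (by rwa [ne_eq, ENNReal.ofReal_eq_zero, not_le])) (Or.inl ENNReal.ofReal_ne_top), mul_comm]
    exact h3
  -- square: `2^j ≤ R²`, contradiction with `j > N > R²` (since `2^j > j`)
  have h5 : ((2 : ℝ≥0∞) ^ ((j : ℝ) / 2)).toReal ≤ R.toReal := ENNReal.toReal_mono hRtop h4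
  have h6 : ((2 : ℝ≥0∞) ^ ((j : ℝ) / 2)).toReal ^ 2 = (2 : ℝ) ^ (j : ℕ) := by
    rw [← ENNReal.toReal_pow, ← ENNReal.rpow_natCast, ← ENNReal.rpow_mul, ← ENNReal.toReal_rpow]
    norm_num
  have h7 : (2 : ℝ) ^ (j : ℕ) ≤ R.toReal ^ 2 := by rw [← h6]; gcongr
  have h8 : (N : ℝ) < j := by exact_mod_cast hjN
  have h9 : (j : ℝ) < (2 : ℝ) ^ (j : ℕ) := by exact_mod_cast Nat.lt_two_pow_self
  linarith

/-- A translated lower integral: `∫⁻_{(s,t]} g(τ - σ) dτ = ∫⁻_{(s-σ, t-σ]} g`. [folklore] -/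
private theorem setLIntegral_Ioc_comp_sub (g : ℝ → ℝ≥0∞) (s t σ : ℝ) :
    ∫⁻ τ in Ioc s t, g (τ - σ) = ∫⁻ τ in Ioc (s - σ) (t - σ), g τ := by
  rw [← lintegral_indicator measurableSet_Ioc, ← lintegral_indicator measurableSet_Ioc,
    ← lintegral_sub_right_eq_self (fun τ => (Ioc (s - σ) (t - σ)).indicator g τ) σ]
  refine lintegral_congr fun τ => ?_
  by_cases h : τ ∈ Ioc s t
  · have h' : τ - σ ∈ Ioc (s - σ) (t - σ) := ⟨by linarith [h.1], by linarith [h.2]⟩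
    rw [indicator_of_mem h, indicator_of_mem h']
  · have h' : τ - σ ∉ Ioc (s - σ) (t - σ) := fun h' => h ⟨by linarith [h'.1], by linarith [h'.2]⟩
    rw [indicator_of_notMem h, indicator_of_notMem h']

/-- **One piece, low-mode form.** Let `u` be Leray–Hopf on `[0,T)`, `ν > 0`, and let Leray's regular
local solutions be available (`LerayLocalRegularH1With c₀`). Assume the low-mode bound on the weighted
nonlinear terms for smooth divergence-free slices (the output of `CheskidovDaiWeightedSum`, constants
`B_f, B_κ < ∞`), a threshold `c > 0` with `B_κ (cν) C_r² d ≤ ν`, and `‖u(t)‖₂ ≤ E₀`. From a good time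
`σ` with `‖∇u(σ)‖²₂ ≤ A` and a lifespan `d` with `A² d ≤ c₀ ν³`: the slices `u(t)`, `t ∈ (σ, σ + d]`,
are a.e. smooth `L²` fields, and on every `[σ + a', σ + b']` (`0 < a' < b' ≤ d`, `σ + b' < T`) the dyadic
energy `f(t) = F(u(t)).toReal` satisfies the two-point inequality with the interval functional
`2 (B_f ∫⁻_{(s,t]} f_{J(τ)}(u(τ)) dτ).toReal`, `J(τ) = sup` of the saturated levels of `u(τ)`, is bounded,
and the occupation integrands are a.e.-measurable there (the proof of Lemma 3.2 of Cheskidov–Shvydkoy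
with Cheskidov–Dai's rate). [cite: CheskidovDai2015, §3.1 (3.8)] -/
theorem piece_lowMode (K : LPBounds (Fin 3)) (hν : 0 < ν) (hLH : IsLerayHopfOn T ν 0 u₀ u)
    {c₀ : ℝ} (hreg : LerayLocalRegularH1With c₀) {c : ℝ} (hc : 0 < c) {Bf Bκ : ℝ≥0∞} (hBf : Bf ≠ ∞) (hBκ : Bκ ≠ ∞)
    (hNL : ∀ w : EuclideanSpace ℝ (Fin 3) → EuclideanSpace ℝ (Fin 3), IsSmoothL2Field w → VectorCalculus.IsDivFree w →
      ∀ (J : ℤ) (κ : ℝ≥0∞) (L : ℕ), (∀ l, J < l → blockSup w l ≤ κ * (2 : ℝ≥0∞) ^ l) →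
        ∑ j ∈ Finset.Icc (-(L : ℤ)) L, (2 : ℝ≥0∞) ^ (2 * j) * ‖∫ x, ⟪blockFn j w x, blockFn j (convect w w) x⟫‖ₑ ≤
          Bf * ((∑' n : ℕ, (2 : ℝ≥0∞) ^ (J - n) * blockSup w (J - n)) * dyadicF w) +
            Bκ * (κ * dyadicSqSum (fun l => (2 : ℝ≥0∞) ^ l * blockL2 w l)))
    (hsmall : Bκ * ENNReal.ofReal (c * ν) * (K.Cr : ℝ≥0∞) ^ 2 * Fintype.card (Fin 3) ≤ ENNReal.ofReal ν)
    {E₀ : ℝ≥0} (hE₀ : ∀ τ ∈ Icc 0 T, eLpNorm (u τ) 2 volume ≤ E₀)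
    {σ : ℝ} (hσ : σ ∈ Ioo 0 T) (hLHσ : IsLerayHopfOn (T - σ) ν 0 (u σ) (fun t => u (t + σ)))
    {A d : ℝ} (hA : 0 ≤ A) (hAσ : eWeakGradL2Sq (u σ) ≤ ENNReal.ofReal A) (hd : 0 < d) (hσd : σ + d ≤ T)
    (hAd : A ^ 2 * d ≤ c₀ * ν ^ 3) :
    (∀ τ ∈ Ioc σ (σ + d), ∃ w : EuclideanSpace ℝ (Fin 3) → EuclideanSpace ℝ (Fin 3), IsSmoothL2Field w ∧ u τ =ᵐ[volume] w) ∧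
    (∀ a' b' : ℝ, 0 < a' → a' < b' → b' ≤ d → σ + b' < T →
      (∀ s ∈ Icc (σ + a') (σ + b'), ∀ t ∈ Icc s (σ + b'),
        (dyadicF (u t)).toReal ≤ (dyadicF (u s)).toReal +
          2 * (Bf * ∫⁻ τ in Ioc s t, ∑' n : ℕ, (2 : ℝ≥0∞) ^ (((sSup {j : ℕ | IsSaturatedLevel c ν (u τ) j} : ℕ) : ℤ) - n) *
            blockSup (u τ) (((sSup {j : ℕ | IsSaturatedLevel c ν (u τ) j} : ℕ) : ℤ) - n)).toReal *
          sSup ((fun τ => (dyadicF (u τ)).toReal) '' Icc s t)) ∧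
      (∃ B : ℝ, ∀ τ ∈ Icc (σ + a') (σ + b'), (dyadicF (u τ)).toReal ≤ B) ∧
      (∀ q : ℕ, AEMeasurable (fun τ => {τ' : ℝ | (2 : ℝ≥0∞) ^ q ≤ dissipationWavenumber c ν (u τ')}.indicator
        (fun τ' => (2 : ℝ≥0∞) ^ q * eLpNorm (blockFn (q : ℤ) (u τ')) ∞ volume) τ)
        (volume.restrict (Icc (σ + a') (σ + b')))) ∧
      (∃ M : ℝ≥0∞, M ≠ ∞ ∧ ∀ τ ∈ Icc (σ + a') (σ + b'),
        ∑' n : ℕ, (2 : ℝ≥0∞) ^ (((sSup {j : ℕ | IsSaturatedLevel c ν (u τ) j} : ℕ) : ℤ) - n) *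
            blockSup (u τ) (((sSup {j : ℕ | IsSaturatedLevel c ν (u τ) j} : ℕ) : ℤ) - n) ≤ M)) := by
  have hu2 : MemLp (u σ) 2 volume := hLH.memLp σ ⟨hσ.1.le, hσ.2.le⟩
  have hdiv : IsWeaklyDivFree (u σ) := hLHσ.isWeaklyDivFree_datum (sub_pos.2 hσ.2)
  obtain ⟨v, p, hv, hv0, hvreg, hns, hcl⟩ := hreg hν hd hu2 hdiv hA hAσ hAd
  -- weak–strong uniqueness on `(0, d]`
  have hLHσ' : IsLerayHopfOn d ν 0 (u σ) (fun t => u (t + σ)) := hLHσ.of_le (by linarith)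
  have hS : MemLqLp ∞ 6 v (Ioo 0 d) :=
    memLqLp_top_six_of_isH1RegularOn_Icc hvreg fun t ht => hv.memLp t ht
  have hqr : 2 / (∞ : ℝ≥0∞) + 3 / 6 ≤ 1 := by
    rw [ENNReal.div_top, zero_add]
    exact ENNReal.div_le_of_le_mul (by norm_num)
  have hae : ∀ t ∈ Ioc 0 d, u (t + σ) =ᵐ[volume] v t := fun t ht =>
    serrin_weak_strong_uniqueness_holds hν hd hv hu2 (q := ∞) (r := 6) (by norm_num) hqr hS hLHσ' t ht
  have hae' : ∀ τ ∈ Ioc σ (σ + d), u τ =ᵐ[volume] v (τ - σ) := by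
    intro τ hτ
    have h := hae (τ - σ) ⟨sub_pos.2 hτ.1, by linarith [hτ.2]⟩
    rwa [sub_add_cancel] at h
  refine ⟨fun τ hτ => ?_, fun a' b' ha' hab' hb'd hσb' => ?_⟩
  · obtain ⟨hSob, -, hsup, -⟩ := hcl (τ - σ) (sub_pos.2 hτ.1) (by linarith [hτ.2])
    exact ⟨v (τ - σ), isSmoothL2Field_slice_of_regular hns (sub_pos.2 hτ.1) hSob hsup
      ⟨le_rfl, by linarith [hτ.2]⟩, hae' τ hτ⟩
  · -- the slab `[a', b']` of `v`
    obtain ⟨hSob, hSobdt, hsup, hp⟩ := hcl a' ha' (hab'.le.trans hb'd)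
    have hslab : IsSmoothSlabSolution a' b' ν v p := isSmoothSlabSolution_of_regular hns ha' hab' hb'd hSob hSobdt hsup hp
    obtain ⟨S₁, S₃, hSS⟩ := exists_gradSq_thirdSum_le (v := v) (hSob.mono (Icc_subset_Icc le_rfl hb'd)) hslab.smooth_slice
    have hmemI : ∀ t ∈ Icc a' b', t ∈ Ioc 0 d := fun t ht => ⟨ha'.trans_le ht.1, ht.2.trans hb'd⟩
    have hEv : ∀ t ∈ Icc a' b', eLpNorm (v t) 2 volume ≤ E₀ := by
      intro t ht
      rw [← eLpNorm_congr_ae (hae t (hmemI t ht))]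
      exact hE₀ (t + σ) ⟨by linarith [ht.1, hσ.1], by linarith [ht.2]⟩
    -- saturated levels are bounded on the slab, so the cut is finite and bounded
    set Fmax : ℝ≥0∞ := 8 * (Fintype.card (Fin 3) * ((K.Cr : ℝ≥0∞) ^ 2 * S₁)) with hFmax
    have hFmax_top : Fmax ≠ ∞ := ENNReal.mul_ne_top (by norm_num) (ENNReal.mul_ne_top (ENNReal.natCast_ne_top _)
      (ENNReal.mul_ne_top (ENNReal.pow_ne_top ENNReal.coe_ne_top) ENNReal.coe_ne_top))
    have hFle : ∀ t ∈ Icc a' b', dyadicF (v t) ≤ Fmax := fun t ht =>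
      dyadicF_le_of_gradSq_le K (hslab.smooth_slice t ht) (hSS t ht).1
    obtain ⟨N, hN⟩ := exists_bound_saturatedLevel K (mul_pos hc hν) hFmax_top
    have hN' : ∀ t ∈ Icc a' b', ∀ j : ℕ, IsSaturatedLevel c ν (v t) j → j ≤ N := fun t ht j hj =>
      hN (v t) (hslab.smooth_slice t ht) (hFle t ht) j hj
    have hΛ : ∀ t ∈ Icc a' b', dissipationWavenumber c ν (v t) < ∞ := fun t ht =>
      (dissipationWavenumber_lt_top_iff c ν (v t)).2 ⟨N, fun j hj hsat => (not_le.2 hj) (hN' t ht j hsat)⟩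
    set Jv : ℝ → ℕ := fun t => sSup {j : ℕ | IsSaturatedLevel c ν (v t) j} with hJv
    have hJvN : ∀ t ∈ Icc a' b', Jv t ≤ N := fun t ht => csSup_le' fun j hj => hN' t ht j hj
    have hJtop : ∀ t ∈ Icc a' b', (∀ j : ℕ, Jv t < j → ¬ IsSaturatedLevel c ν (v t) j) ∧
        (Jv t = 0 ∨ IsSaturatedLevel c ν (v t) (Jv t)) := fun t ht => topLevel_sSup (hΛ t ht)
    set κ : ℝ≥0∞ := ENNReal.ofReal (c * ν) with hκ
    have hblock : ∀ t ∈ Icc a' b', ∀ l : ℤ, ((Jv t : ℕ) : ℤ) < l → blockSup (v t) l ≤ κ * (2 : ℝ≥0∞) ^ l :=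
      fun t ht l hl => blockSup_le_of_topLevel (hJtop t ht).1 l hl
    -- the low-mode bound slice by slice, and the bound on the low-mode factors
    have hNLv : ∀ τ ∈ Icc a' b', ∀ L : ℕ, ∑ j ∈ Finset.Icc (-(L : ℤ)) L, (2 : ℝ≥0∞) ^ (2 * j) *
        ‖∫ x, ⟪blockFn j (v τ) x, blockFn j (convect (v τ) (v τ)) x⟫‖ₑ ≤
      Bf * ((∑' n : ℕ, (2 : ℝ≥0∞) ^ (((Jv τ : ℕ) : ℤ) - n) * blockSup (v τ) (((Jv τ : ℕ) : ℤ) - n)) * dyadicF (v τ)) +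
        Bκ * (κ * dyadicSqSum (fun l => (2 : ℝ≥0∞) ^ l * blockL2 (v τ) l)) := fun τ hτ L =>
      hNL (v τ) (hslab.smooth_slice τ hτ) (hslab.ns.divFree τ hτ) _ κ L (hblock τ hτ)
    set Mf : ℝ≥0∞ := (2 : ℝ≥0∞) ^ (N : ℤ) * (K.Cinf * E₀ * (2 : ℝ≥0∞) ^ (((N : ℤ) : ℝ) * Fintype.card (Fin 3) * 2⁻¹) * LPBounds.geomDim (Fin 3))
      with hMf
    have hMftop : Mf ≠ ∞ := ENNReal.mul_ne_top (two_zpow_ne_top _) (ENNReal.mul_ne_top (ENNReal.mul_ne_top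
      (ENNReal.mul_ne_top ENNReal.coe_ne_top ENNReal.coe_ne_top) (ENNReal.rpow_ne_top_of_nonneg (by positivity) ENNReal.ofNat_ne_top))
      LPBounds.geomDim_lt_top.ne)
    have hMfle : ∀ τ ∈ Icc a' b', ∑' n : ℕ, (2 : ℝ≥0∞) ^ (((Jv τ : ℕ) : ℤ) - n) * blockSup (v τ) (((Jv τ : ℕ) : ℤ) - n) ≤
        (Mf.toNNReal : ℝ≥0∞) := by
      intro τ hτ
      rw [ENNReal.coe_toNNReal hMftop]
      refine (lowSum_le_of_eLpNorm_le K (hv.memLp τ ⟨(hmemI τ hτ).1.le, (hmemI τ hτ).2⟩) _).trans ?_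
      rw [hMf, show ((Jv τ : ℕ) : ℤ) + 1 - 1 = ((Jv τ : ℕ) : ℤ) by ring]
      have hJN : ((Jv τ : ℕ) : ℤ) ≤ (N : ℤ) := by exact_mod_cast hJvN τ hτ
      have hexp : (((Jv τ : ℕ) : ℤ) : ℝ) * Fintype.card (Fin 3) * 2⁻¹ ≤ ((N : ℤ) : ℝ) * Fintype.card (Fin 3) * 2⁻¹ := by
        have : (((Jv τ : ℕ) : ℤ) : ℝ) ≤ ((N : ℤ) : ℝ) := by exact_mod_cast hJvN τ hτ
        have h3 : (0 : ℝ) ≤ Fintype.card (Fin 3) * 2⁻¹ := by positivity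
        nlinarith
      exact mul_le_mul' (ENNReal.zpow_le_of_le (by norm_num) hJN)
        (mul_le_mul' (mul_le_mul' (mul_le_mul' le_rfl (hEv τ hτ))
          (ENNReal.rpow_le_rpow_of_exponent_le (by norm_num) hexp)) le_rfl)
    have h2p := fun (s : ℝ) (hs : s ∈ Icc a' b') (t : ℝ) (ht : t ∈ Icc s b') =>
      hslab.dyadicF_two_point_lowMode K hν.le (Bf := Bf) (Bκ := Bκ) (κ := κ) (E₀ := E₀) (S₁ := S₁) (S₃ := S₃)
        (Mf := Mf.toNNReal) (J := fun τ => ((Jv τ : ℕ) : ℤ)) hNLv hMfle hEv (fun τ hτ => (hSS τ hτ).1)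
        (fun τ hτ => (hSS τ hτ).2) hBf hBκ ENNReal.ofReal_ne_top hsmall hs.1 ht.1 ht.2
    -- translate to `u`
    have hfeq : ∀ t ∈ Icc a' b', (dyadicF (u (t + σ))).toReal = (dyadicF (v t)).toReal := fun t ht => by
      rw [dyadicF_congr_ae (hae t (hmemI t ht))]
    have hJeq : ∀ t ∈ Icc a' b', sSup {j : ℕ | IsSaturatedLevel c ν (u (t + σ)) j} = Jv t := by
      intro t ht
      simp only [hJv]
      congr 1
      ext j
      exact isSaturatedLevel_congr_ae (hae t (hmemI t ht)) j
    have hFJeq : ∀ t ∈ Icc a' b',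
        (∑' n : ℕ, (2 : ℝ≥0∞) ^ (((sSup {j : ℕ | IsSaturatedLevel c ν (u (t + σ)) j} : ℕ) : ℤ) - n) *
          blockSup (u (t + σ)) (((sSup {j : ℕ | IsSaturatedLevel c ν (u (t + σ)) j} : ℕ) : ℤ) - n)) =
        ∑' n : ℕ, (2 : ℝ≥0∞) ^ (((Jv t : ℕ) : ℤ) - n) * blockSup (v t) (((Jv t : ℕ) : ℤ) - n) := by
      intro t ht
      rw [hJeq t ht, blockSup_congr_ae (hae t (hmemI t ht))]
    have himg : ∀ s t, a' ≤ s → t ≤ b' →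
        (fun τ => (dyadicF (u τ)).toReal) '' Icc (σ + s) (σ + t) = (fun τ => (dyadicF (v τ)).toReal) '' Icc s t := by
      intro s t hs ht
      ext y
      constructor
      · rintro ⟨τ, hτ, rfl⟩
        refine ⟨τ - σ, ⟨by linarith [hτ.1], by linarith [hτ.2]⟩, ?_⟩
        simp only
        rcases le_or_gt s t with hst | hst
        · rw [← hfeq (τ - σ) ⟨by linarith [hτ.1], by linarith [hτ.2]⟩, sub_add_cancel]
        · exact absurd (hτ.1.trans hτ.2) (by linarith)
      · rintro ⟨τ, hτ, rfl⟩
        refine ⟨τ + σ, ⟨by linarith [hτ.1], by linarith [hτ.2]⟩, ?_⟩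
        simp only
        rcases le_or_gt s t with hst | hst
        · exact hfeq τ ⟨hs.trans hτ.1, hτ.2.trans ht⟩
        · exact absurd (hτ.1.trans hτ.2) (by linarith)
    refine ⟨fun s hs t ht => ?_, ?_, fun q => ?_, ⟨(Mf.toNNReal : ℝ≥0∞), ENNReal.coe_ne_top, fun τ hτ => ?_⟩⟩
    · -- the two-point inequality
      have hs' : s - σ ∈ Icc a' b' := ⟨by linarith [hs.1], by linarith [hs.2]⟩
      have ht' : t - σ ∈ Icc (s - σ) b' := ⟨by linarith [ht.1], by linarith [ht.2]⟩
      have key := h2p (s - σ) hs' (t - σ) ht'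
      have e1 := hfeq (s - σ) hs'
      have e2 := hfeq (t - σ) ⟨hs'.1.trans ht'.1, ht'.2⟩
      rw [sub_add_cancel] at e1 e2
      have hi := himg (s - σ) (t - σ) hs'.1 ht'.2
      rw [add_sub_cancel, add_sub_cancel] at hi
      -- the rate integrals agree
      have hW : ∫⁻ τ in Ioc s t, ∑' n : ℕ, (2 : ℝ≥0∞) ^ (((sSup {j : ℕ | IsSaturatedLevel c ν (u τ) j} : ℕ) : ℤ) - n) *
            blockSup (u τ) (((sSup {j : ℕ | IsSaturatedLevel c ν (u τ) j} : ℕ) : ℤ) - n) =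
          ∫⁻ τ in Ioc (s - σ) (t - σ), ∑' n : ℕ, (2 : ℝ≥0∞) ^ (((Jv τ : ℕ) : ℤ) - n) * blockSup (v τ) (((Jv τ : ℕ) : ℤ) - n) := by
        rw [← setLIntegral_Ioc_comp_sub]
        refine setLIntegral_congr_fun measurableSet_Ioc fun τ hτ => ?_
        have hτ' : τ - σ ∈ Icc a' b' := ⟨by linarith [hτ.1, hs'.1], by linarith [hτ.2, ht'.2]⟩
        have := hFJeq (τ - σ) hτ'
        rw [sub_add_cancel] at this
        exact this
      rw [e1, e2, hi, hW]
      exact key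
    · -- boundedness
      refine ⟨Fmax.toReal, fun τ hτ => ?_⟩
      have hτ' : τ - σ ∈ Icc a' b' := ⟨by linarith [hτ.1], by linarith [hτ.2]⟩
      have e1 := hfeq (τ - σ) hτ'
      rw [sub_add_cancel] at e1
      rw [e1]
      exact ENNReal.toReal_mono hFmax_top (hFle _ hτ')
    · -- measurability of the occupation integrand
      have hab : σ + a' ≤ σ + b' := by linarith
      set w : ℝ → EuclideanSpace ℝ (Fin 3) → EuclideanSpace ℝ (Fin 3) := fun τ => v (τ - σ) with hw
      have hcont : ContinuousOn (uncurry w) (Icc (σ + a') (σ + b') ×ˢ univ) := by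
        have h1 : ContinuousOn (uncurry v) (Icc a' b' ×ˢ univ) := hslab.regular.smooth.continuousOn
        have h2 : ContinuousOn (fun z : ℝ × EuclideanSpace ℝ (Fin 3) => (z.1 - σ, z.2)) (Icc (σ + a') (σ + b') ×ˢ univ) :=
          ((continuous_fst.sub continuous_const).prodMk continuous_snd).continuousOn
        exact (h1.comp h2 fun z hz => ⟨⟨by linarith [hz.1.1], by linarith [hz.1.2]⟩, mem_univ _⟩).congr fun z _ => rfl
      obtain ⟨M, hM⟩ := hslab.regular.bound
      have hMw : ∀ τ ∈ Icc (σ + a') (σ + b'), ∀ x, ‖w τ x‖ ≤ M := fun τ hτ x =>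
        hM (τ - σ) ⟨by linarith [hτ.1], by linarith [hτ.2]⟩ x
      have hmeas := aemeasurable_occupation_restrict hab hcont hMw c ν q
      refine hmeas.congr ((ae_restrict_mem measurableSet_Icc).mono fun τ hτ => ?_)
      have hτ' : τ ∈ Ioc σ (σ + d) := ⟨by linarith [hτ.1], by linarith [hτ.2]⟩
      have haeτ : u τ =ᵐ[volume] w τ := hae' τ hτ'
      simp only
      rw [show {τ' : ℝ | (2 : ℝ≥0∞) ^ q ≤ dissipationWavenumber c ν (w τ')}.indicator
          (fun τ' => (2 : ℝ≥0∞) ^ q * eLpNorm (blockFn (q : ℤ) (w τ')) ∞ volume) τ =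
        {τ' : ℝ | (2 : ℝ≥0∞) ^ q ≤ dissipationWavenumber c ν (u τ')}.indicator
          (fun τ' => (2 : ℝ≥0∞) ^ q * eLpNorm (blockFn (q : ℤ) (u τ')) ∞ volume) τ from ?_]
      by_cases hm : τ ∈ {τ' : ℝ | (2 : ℝ≥0∞) ^ q ≤ dissipationWavenumber c ν (u τ')}
      · have hm' : τ ∈ {τ' : ℝ | (2 : ℝ≥0∞) ^ q ≤ dissipationWavenumber c ν (w τ')} := by
          simp only [mem_setOf_eq] at hm ⊢; rwa [← dissipationWavenumber_congr_ae haeτ]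
        rw [indicator_of_mem hm, indicator_of_mem hm', blockFn_congr_ae (q : ℤ) haeτ]
      · have hm' : τ ∉ {τ' : ℝ | (2 : ℝ≥0∞) ^ q ≤ dissipationWavenumber c ν (w τ')} := by
          simp only [mem_setOf_eq] at hm ⊢; rwa [← dissipationWavenumber_congr_ae haeτ]
        rw [indicator_of_notMem hm, indicator_of_notMem hm']
    · -- boundedness of the low-mode factor
      have hτ' : τ - σ ∈ Icc a' b' := ⟨by linarith [hτ.1], by linarith [hτ.2]⟩
      have e := hFJeq (τ - σ) hτ'
      rw [sub_add_cancel] at e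
      rw [e]
      exact hMfle _ hτ'

end PieceLowMode

end Literature.Analysis.FluidPDE

end
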